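import Summits.QuantumFields.YangMills.Theorems.ForcedResponseSkewnessRunningCouplingCeilingUniformSmearLocal
import HarnessLib

/-!
# Crux `RunningCouplingCeiling` (repaired: stmt-QuantumFields-24275): the crux BODY from pointwise kernel bounds
# (Theses-free twin of `…RunningCouplingCeilingOfKernelBounds`, landed while the farm was incoherent on the route module)

Support file (`--supports stmt-QuantumFields-24275`) by the width prover `ym-line-frs-p3` of route `ForcedResponseSkewness`
(lead `ym-line-frs-p1`).  The REPAIRED crux (route rev 2: compactly supported floor witness `v₀`; ceiling constant `C`
uniform over `L¹`-normalised sources in `closedBall p ρ₀`, `ρ₀ < p₀`; thresholds after the source) follows from the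
PHYSICS half of line `pointwise-log-ceiling` alone — pointwise ceilings `KernelBounds C₀ C₁ C₂ n₀ (a β) L (torusCov β L)` on
the torus covariance of the action densities for all large `β` and all tori `a(β)·L ≥ Λ₀`, granted a clause-(i) floor for
some compactly supported positive-time `v₀` — by the uniform smearing theorem `uniform_smear`
(`…RunningCouplingCeilingUniformSmear`): `runningCouplingCeilingBody_of_pointwiseSigR : PointwiseSigR → «body of RunningCouplingCeiling, verbatim»` (this file does
not import the route file: after route rev 3 the farm could not serve `Theses/ForcedResponseSkewness` for an hour, so the
conclusion is the crux text itself; the named one-liners `… : RunningCouplingCeiling := runningCouplingCeilingBody_of_… h` live in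
`…RunningCouplingCeilingOfKernelBounds`)
(`PointwiseSigR` = the lead's registered physics stub of line «pointwise-log-ceiling-r», Defs append p592985), so the
re-registered skeleton on 24275 closes with the landed smear stub and this composition; `localKernelBounds_of_kernelBounds`
records that the registered kernel bounds imply the local ones.  The sharper
`runningCouplingCeilingBody_of_localKernelBounds` (via `uniform_smear_local`, `…UniformSmearLocal`) asks the physics only for
LOCAL kernel bounds: for every physical radius `ℓ > 0`, constants `C₀ C₁ n₀ β₀ Λ₀` with the scale-free clause
`d⁸|Cov| ≤ C₁` at physical separations `a(β)·d ≤ ℓ` (hyperscaling at fixed physical separation, E0′/MomentBounds-class) and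
the running-coupling clause `d⁸|Cov| ≤ C₀/log²(1/(a(β) d))` below half the unit — no bounded clause, no decay at all torus
distances (which would be IR/clustering content).

Honest label: a CONDITIONAL reduction inside a conditional rung line (leaf R2a `BalabanLadder.NT`); the kernel bounds
(Bałaban-class running-coupling decay of the dens–dens covariance + floor-pins-unit) are NOT proved here; nothing in this
file bears on the Yang–Mills mass gap, which is NOT proved by any of this.
-/

set_option autoImplicit false

noncomputable section

namespace Summit.QuantumFields.YangMills.Cruxes.RunningCouplingCeiling.Pointwise

open scoped SchwartzMap
open MeasureTheory Filter Topology
open Literature.MathematicalPhysics.QuantumFieldTheory Literature.MathematicalPhysics.QuantumLattice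
open Literature.Probability.LatticeModels
open Summit.QuantumFields.YangMills.Cruxes.OSLegsFromFemtoAndGap.DlrCollarTransfer

/-- **The repaired crux `RunningCouplingCeiling` (stmt-QuantumFields-24275) from the registered physics stub
`PointwiseSigR`** (line «pointwise-log-ceiling-r», lead's Defs append p592985): floor with a compactly supported `v₀` ⇒
`KernelBounds C₀ C₁ C₂ n₀ (a β) L (torusCov β L)` for `β ≥ β₀`, tori `a(β)·L ≥ Λ₀`; then `uniform_smear` gives the crux
(constant of `uniform_smear`; thresholds `β₆ = max β₀ β₁` with `a β ≤ t₀` for `β ≥ β₁`, `Λ₆ = max Λ₀ Λ₆'`;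
`Q2 = Σ θv ⊗ v · torusCov` by `Q2_eq_sum_torusCov`).  Equivalently: `PointwiseSigR → SmearUniformSig → RunningCouplingCeiling`
with the registered smear stub discharged. [folklore] -/
theorem runningCouplingCeilingBody_of_pointwiseSigR (hpt : PointwiseSigR) :
    (open Literature.MathematicalPhysics.QuantumFieldTheory Literature.MathematicalPhysics.QuantumLattice Summit.QuantumFields.YangMills.Cruxes.OSLegsFromFemtoAndGap.DlrCollarTransfer in ∀ (G : Type) [Group G] [TopologicalSpace G] [IsTopologicalGroup G] [CompactSpace G], IsCompactSimpleLieGroup G → letI : MeasurableSpace G := borel G; haveI : BorelSpace G := ⟨rfl⟩; ∀ (r : LatticeRep G) (a : ℝ → ℝ), (∀ β, 0 < a β) → Filter.Tendsto a Filter.atTop (nhds 0) → (∃ (v₀ : SchwartzMap (EuclideanSpace ℝ (Fin 4)) ℝ) (ε β₅ Λ₅ : ℝ), HasCompactSupport v₀ ∧ tsupport v₀ ⊆ {y : EuclideanSpace ℝ (Fin 4) | 0 < y 0} ∧ 0 < ε ∧ ∀ β : ℝ, β₅ ≤ β → ∀ L : ℕ, Λ₅ ≤ a β * L → ε ≤ Q2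 G r β L (a β) (thetaTest 4 v₀) v₀) → ∀ (p : EuclideanSpace ℝ (Fin 4)) (ρ₀ : ℝ), 0 < ρ₀ → ρ₀ < p 0 → ∃ C : ℝ, ∀ v : SchwartzMap (EuclideanSpace ℝ (Fin 4)) ℝ, tsupport v ⊆ Metric.closedBall p ρ₀ → (∫ y, |v y|) ≤ 1 → ∀ Λ : ℝ, 2 ≤ Λ → ∃ β₆ Λ₆ : ℝ, ∀ β : ℝ, β₆ ≤ β → ∀ L : ℕ, Λ₆ ≤ a β * L → ∀ l : ℝ, l ∈ Set.Icc Λ (2 * Λ) → Q2 G r β L (l * a β) (thetaTest 4 v) v ≤ C / Real.log Λ ^ 2) := by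
  intro G _ _ _ _ hG
  letI : MeasurableSpace G := borel G
  haveI : BorelSpace G := ⟨rfl⟩
  intro r a hapos hlim hfloor p ρ₀ _hρ₀ hp
  obtain ⟨C₀, C₁, C₂, n₀, β₀, Λ₀, hK⟩ := hpt G hG r a hapos hlim hfloor
  obtain ⟨C, hC⟩ := uniform_smear C₀ C₁ C₂ n₀ p ρ₀ hp
  refine ⟨C, fun v hv hint Λ hΛ => ?_⟩
  obtain ⟨t₀, Λ₆, ht₀, h⟩ := hC v hv hint Λ hΛ
  obtain ⟨β₁, hβ₁⟩ := Filter.eventually_atTop.1 (hlim.eventually (Iic_mem_nhds ht₀))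
  refine ⟨max β₀ β₁, max Λ₀ Λ₆, fun β hβ L hL l hl => ?_⟩
  have hb := h (a β) (hapos β) (hβ₁ β (le_trans (le_max_right _ _) hβ)) L
    (le_trans (le_max_right _ _) hL) (torusCov G r β L)
    (hK β (le_trans (le_max_left _ _) hβ) L (le_trans (le_max_left _ _) hL)) l hl
  rw [Q2_eq_sum_torusCov]
  exact hb

/-- **The registered kernel bounds imply the local ones** (any radius `ℓ`): `KernelBounds` asserts the scale-free clause
at ALL torus distances `≥ n₀`, the local form only at physical separation `≤ ℓ`. [folklore] -/
theorem localKernelBounds_of_kernelBounds {C₀ C₁ C₂ : ℝ} {n₀ : ℕ} {t ℓ : ℝ} {L : ℕ}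
    {K : (Fin 4 → ℤ) → (Fin 4 → ℤ) → ℝ} (hK : KernelBounds C₀ C₁ C₂ n₀ t L K) :
    ∀ x ∈ box 4 L, ∀ y ∈ box 4 L,
      (((n₀ : ℝ) ≤ torusDist L x y → t * torusDist L x y ≤ ℓ → torusDist L x y ^ 8 * |K x y| ≤ C₁) ∧
       ((n₀ : ℝ) ≤ torusDist L x y → t * torusDist L x y ≤ 1 / 2 →
          torusDist L x y ^ 8 * |K x y| ≤ C₀ / Real.log (1 / (t * torusDist L x y)) ^ 2)) := by
  intro x hx y hy
  obtain ⟨_, h1, h0⟩ := hK x hx y hy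
  exact ⟨fun hn _ => h1 hn, h0⟩

/-- **The repaired crux `RunningCouplingCeiling` (stmt-QuantumFields-24275) from LOCAL pointwise kernel bounds.**  If for
every compact simple `G`, `r`, unit map `a → 0⁺` carrying a clause-(i) floor for some compactly supported positive-time `v₀`
and every physical radius `ℓ > 0` there are `C₀ C₁ n₀ β₀ Λ₀` such that for `β ≥ β₀`, tori `a(β)·L ≥ Λ₀` and all
`x, y ∈ box L` (torus distance `d`): `n₀ ≤ d → a(β) d ≤ ℓ → d⁸|Cov| ≤ C₁` (hyperscaling at physical separation `≤ ℓ`) and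
`n₀ ≤ d → a(β) d ≤ ½ → d⁸|Cov| ≤ C₀/log²(1/(a(β) d))` (running-coupling decay below the unit), `Cov = torusCov β L x y`,
then `RunningCouplingCeiling` holds (radius `ℓ = 2(‖p‖ + |ρ₀| + 1)` for the ball `closedBall p ρ₀`; constant of
`uniform_smear_local`; thresholds `max`). [folklore] -/
theorem runningCouplingCeilingBody_of_localKernelBounds
    (hpt : ∀ (G : Type) [Group G] [TopologicalSpace G] [IsTopologicalGroup G] [CompactSpace G],
      IsCompactSimpleLieGroup G →
      letI : MeasurableSpace G := borel G
      haveI : BorelSpace G := ⟨rfl⟩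
      ∀ (r : LatticeRep G) (a : ℝ → ℝ), (∀ β, 0 < a β) → Filter.Tendsto a Filter.atTop (nhds 0) →
        (∃ (v₀ : 𝓢(EuclideanSpace ℝ (Fin 4), ℝ)) (ε β₅ Λ₅ : ℝ), HasCompactSupport v₀ ∧
          tsupport v₀ ⊆ {y : EuclideanSpace ℝ (Fin 4) | 0 < y 0} ∧ 0 < ε ∧
          ∀ β : ℝ, β₅ ≤ β → ∀ L : ℕ, Λ₅ ≤ a β * L → ε ≤ Q2 G r β L (a β) (thetaTest 4 v₀) v₀) →
        ∀ ℓ : ℝ, 0 < ℓ → ∃ C₀ C₁ : ℝ, ∃ n₀ : ℕ, ∃ β₀ Λ₀ : ℝ, ∀ β : ℝ, β₀ ≤ β → ∀ L : ℕ, Λ₀ ≤ a β * L →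
          ∀ x ∈ box 4 L, ∀ y ∈ box 4 L,
            (((n₀ : ℝ) ≤ torusDist L x y → a β * torusDist L x y ≤ ℓ →
                torusDist L x y ^ 8 * |torusCov G r β L x y| ≤ C₁) ∧
             ((n₀ : ℝ) ≤ torusDist L x y → a β * torusDist L x y ≤ 1 / 2 →
                torusDist L x y ^ 8 * |torusCov G r β L x y| ≤
                  C₀ / Real.log (1 / (a β * torusDist L x y)) ^ 2))) :
    (open Literature.MathematicalPhysics.QuantumFieldTheory Literature.MathematicalPhysics.QuantumLattice Summit.QuantumFields.YangMills.Cruxes.OSLegsFromFemtoAndGap.DlrCollarTransfer in ∀ (G : Type) [Group G] [TopologicalSpace G] [IsTopologicalGroup G] [CompactSpace G], IsCompactSimpleLieGroup G → letI : MeasurableSpace G := borel G; haveI : BorelSpace G := ⟨rfl⟩; ∀ (r : LatticeRep G) (a : ℝ → ℝ), (∀ β, 0 < a β) → Filter.Tendsto a Filter.atTop (nhds 0) → (∃ (v₀ : SchwartzMap (EuclideanSpace ℝ (Fin 4)) ℝ) (ε β₅ Λ₅ : ℝ), HasCompactSupport v₀ ∧ tsupport v₀ ⊆ {y : EuclideanSpace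 ℝ (Fin 4) | 0 < y 0} ∧ 0 < ε ∧ ∀ β : ℝ, β₅ ≤ β → ∀ L : ℕ, Λ₅ ≤ a β * L → ε ≤ Q2 G r β L (a β) (thetaTest 4 v₀) v₀) → ∀ (p : EuclideanSpace ℝ (Fin 4)) (ρ₀ : ℝ), 0 < ρ₀ → ρ₀ < p 0 → ∃ C : ℝ, ∀ v : SchwartzMap (EuclideanSpace ℝ (Fin 4)) ℝ, tsupport v ⊆ Metric.closedBall p ρ₀ → (∫ y, |v y|) ≤ 1 → ∀ Λ : ℝ, 2 ≤ Λ → ∃ β₆ Λ₆ : ℝ, ∀ β : ℝ, β₆ ≤ β → ∀ L : ℕ, Λ₆ ≤ a β * L → ∀ l : ℝ, l ∈ Set.Icc Λ (2 * Λ) → Q2 G r β L (l * a β) (thetaTest 4 v) v ≤ C / Real.log Λ ^ 2) := by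
  intro G _ _ _ _ hG
  letI : MeasurableSpace G := borel G
  haveI : BorelSpace G := ⟨rfl⟩
  intro r a hapos hlim hfloor p ρ₀ _hρ₀ hp
  have hℓ : 0 < 2 * (‖p‖ + |ρ₀| + 1) := by positivity
  obtain ⟨C₀, C₁, n₀, β₀, Λ₀, hK⟩ := hpt G hG r a hapos hlim hfloor (2 * (‖p‖ + |ρ₀| + 1)) hℓ
  obtain ⟨C, hC⟩ := uniform_smear_local C₀ C₁ n₀ p ρ₀ hp (2 * (‖p‖ + |ρ₀| + 1)) le_rfl
  refine ⟨C, fun v hv hint Λ hΛ => ?_⟩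
  obtain ⟨t₀, Λ₆, ht₀, h⟩ := hC v hv hint Λ hΛ
  obtain ⟨β₁, hβ₁⟩ := Filter.eventually_atTop.1 (hlim.eventually (Iic_mem_nhds ht₀))
  refine ⟨max β₀ β₁, max Λ₀ Λ₆, fun β hβ L hL l hl => ?_⟩
  have hb := h (a β) (hapos β) (hβ₁ β (le_trans (le_max_right _ _) hβ)) L
    (le_trans (le_max_right _ _) hL) (torusCov G r β L)
    (hK β (le_trans (le_max_left _ _) hβ) L (le_trans (le_max_left _ _) hL)) l hl
  rw [Q2_eq_sum_torusCov]
  exact hb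

end Summit.QuantumFields.YangMills.Cruxes.RunningCouplingCeiling.Pointwise

end
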